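import Summits.Ventures.Crystal3D.Theorems.StickyWulffConstantCoaxialWallLawSeamGradedRow
import Summits.Ventures.Crystal3D.Theorems.StickyWulffConstantCoaxialWallLawEndRowRootTransport
import HarnessLib

/-!
# The BI-FRAME ROOT-CLASS graded row certificate `BiFrameRootGradedCapWin₃ s` and the LINK to lane T's root row `EndRowBiFrameRootA v2 s`
# (lane T, crux `TextureLiminfV5`, stmt-Ventures-23912, registered stub `stub_terraceCensus`; cf-p1 RULING (ccc)(2)(ii) «LINK», asked of the 19481 lineage;
#  packaging of '…SeamGradedRow' `localSummandA_le_of_threePayer_of_gradedWin₃` for TWO UNRELATED frames and ROOT-CLASS moves only)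

HONEST FRAMING. Venture `Summits/Ventures/Crystal3D` (cell `crystal3d-full`), route `route-Ventures-StickyWulffConstant`.  CONDITIONAL packaging: the new
named input `BiFrameRootGradedCapWin₃ s` (certificate-shaped, window form) and `ThreePayerRoot` (the three-payer floor at ROOT-CLASS end balls; implied by
lane F's `ThreePayer`, `threePayerRoot_of_threePayer`) are HYPOTHESES — neither is proved here or anywhere yet; no census fact is proved; F-C1 not moved.

WHY (cf-p1 (ccxcviii)/(ccc)).  Lane F's row certificate of record `UnionCoreGradedCapWin₃ s` ('…SeamGradedRow') is a SINGLE-COAXIAL-FAMILY row: standard systems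
`(basalSystem refl, basalSystem H)`, transported by ONE frame.  The (β) plates side of lane T pools the cut hexagon censuses of two UNRELATED grains under one row
for the pair `(⟨G₁, inPlaneRoots G₁ 1⟩, ⟨G₂, inPlaneRoots G₂ (−1)⟩)` and only ever produces STRAIGHT ROOT-CLASS endings, so the weakest sufficient input is the
root row `EndRowBiFrameRootA v sF` ('…EndRowRootDefs', 19480-p2 g16; consumer `hexagon_twoPlate_sources_le_payers_cuts_root`, '…LevelReachHexagonPooledRoot').
This file states the certificate that delivers it and proves the delivery:

* `ThreePayerRoot` — pooled deficiency `≥ 3` at every ROOT-CLASS end ball `b ≠ z` within `1` of a payer `z` (any version, any slot-rooted systems);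
  `threePayerRoot_of_threePayer` (lane F's `stub_threePayer` feeds it by name); `isRootEndPair_straight` (a root-class end move is a STRAIGHT move: the
  cross clause would force `‖S.G₀ r‖ = √(2/3)`);
* the ROOT CORE `rootCore Y z v S₁ S₂` (capping closure of the pieces carrying a root-class pair near `z`) and its star closure `rootCoreStar` — verbatim the
  shapes of `unionCore` / `unionCoreStar` with `IsEndPairRootA` for `IsEndPairA`; `isRootEndPair_of_closed_superset` (root pairs descend to any cap-closed
  superset of the reader's piece, SAME root), **`isEndPairRootA_rootCoreStar`**, `endMultRootA_le_rootCoreStar`;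
* `gradedRootSummand₃ v S₁ S₂ X D z := Σ_{b ∈ D : dist z b ≤ 1, endMultRootA D b > 0} endMultRootA D b / gradedPool₃ X D z b` (graded pools of '…SeamGradedRow',
  floor `3` at `b ≠ z`); **`localStatRootA_le_gradedRootSummand₃_rootCoreStar (h3 : ThreePayerRoot)`**;
* **`BiFrameRootGradedCapWin₃ s`** (NAMED INPUT, window form): for every frame `M` and every finite `1`-separated `Y ⊆ B̄(0, 3)` containing the payer `0` with degree
  `≤ 11`, the graded floor-3 ROOT summand (`v2`) of the systems `(basalSystem refl, basalSystem M)` on the star-closed root core is `≤ s`;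
  `biFrameRootGradedCapWin₃_mono`;
* **`localStatRootA_le_of_threePayerRoot_of_biFrameWin₃ (h3) (h) (G₁ G₂)`** — `localStatRootA v2 (basalSystem G₁) (basalSystem G₂) Y z ≤ s` at EVERY frame pair
  and payer (transport `z ↦ 0`, `G₁ ↦ refl`, `G₂ ↦ G₂ ≫ G₁⁻¹`; radius-`3` locality, '…EndRowRootTransport');
  `localEndRowRootA_basal_of_biFrameWin₃`, `localEndRowRootA_of_roots` (antitone in the root sets),
  **`endRowBiFrameRootA_of_threePayerRoot_of_biFrameWin₃ : ThreePayerRoot → BiFrameRootGradedCapWin₃ s → EndRowBiFrameRootA WordVersion.v2 s`** and the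
  `ThreePayer` form — the by-name LINK cf-p1 asked for (lane T registers the `9/2` instance).
WHY IT MIGHT FAIL (the certificate, not this file): coincidence frames `M` (module frames: Σ3ⁿ/Σ9/…) stack the two families' root loads on one payer — BIFAM-PROBE
(19481-p1 g21, kit j336468): depth-1 classes max `F = 1.565`, `e_z ≤ 9`; generic `M` needs the split «no ball pair is a root pair of both systems» plus a packing
count of cross-family loads (cf-p1 (ccc)(2)(iii), cf-p2 lineage).
WHAT THIS IS NOT: the certificate, `ThreePayer(Root)`, the discharge, any census fact; lane F is untouched; F-C1 not moved.
-/

noncomputable section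

namespace Summit.Ventures.Crystal3D.Theorems

namespace TailResidue

open Summit.Ventures.Crystal3D Finset
open scoped InnerProductSpace

/-! ### Root-class end moves are straight; the three-payer floor at root-class ends -/

/-- **A root-class end move is a STRAIGHT move**: the data of `IsRootEndPair X v S b q` with the straight reading at `q` exposed (the cross clause of `IsEndMove`
would give `b = q − (d − 2⟪d, m⟫ m)` and `b = q + d` at once, forcing `‖d‖ = √(2/3) ≠ 1` for the slot image `d = S.G₀ r`). -/
theorem isRootEndPair_straight {X : Finset (EuclideanSpace ℝ (Fin 3))} {v : WordVersion} {S : PlateSystem} (hS : S.RT ⊆ fccSlots)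
    {b q : EuclideanSpace ℝ (Fin 3)} (hp : IsRootEndPair X v S b q) :
    ∃ r ∈ S.RT, q ∈ X ∧ b ∈ X ∧ HasTwoPayers X b ∧ b = q + S.G₀ r ∧ q - S.G₀ r ∈ X ∧
      (IsFull X S.G₀ q ∨ (v = WordVersion.v2 ∧ IsNarrow X S.G₀ (S.G₀ r) q) ∨ ∃ m, IsTwinReading X S.G₀ m q ∧ ⟪S.G₀ r, m⟫_ℝ = 0) ∧
      ¬ IsMoving X v S.G₀ (S.G₀ r) b := by
  obtain ⟨hq, hb, hpay, r, hr, hbq, hpred, hmove⟩ := hp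
  refine ⟨r, hr, hq, hb, hpay, hbq, hpred, ?_⟩
  rcases hmove with ⟨hrd, -, hnm⟩ | ⟨m, htw, hdm, hb', -⟩
  · exact ⟨hrd, hnm⟩
  · exfalso
    set d := S.G₀ r with hd
    have hd1 : ‖d‖ = 1 := by rw [hd, LinearIsometryEquiv.norm_map, norm_eq_one_of_mem_fccSlots (hS hr)]
    have hm1 : ‖m‖ = 1 := htw.1.1
    have e1 : q + d = q + -(d - (2 * ⟪d, m⟫_ℝ) • m) := by rw [← sub_eq_add_neg, ← hb', ← hbq]
    have e2 : d = -(d - (2 * ⟪d, m⟫_ℝ) • m) := add_left_cancel e1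
    have e3 : (2 : ℝ) • d = (2 * Real.sqrt (2 / 3)) • m := by
      rw [hdm] at e2; rw [two_smul]; nth_rewrite 1 [e2]; abel
    have hn := congrArg (fun x : EuclideanSpace ℝ (Fin 3) => ‖x‖) e3
    simp only [norm_smul, hd1, hm1, mul_one, Real.norm_eq_abs] at hn
    have h23 : Real.sqrt (2 / 3) < 1 := by
      rw [show (1 : ℝ) = Real.sqrt 1 by rw [Real.sqrt_one]]
      exact Real.sqrt_lt_sqrt (by norm_num) (by norm_num)
    have hpos : 0 ≤ Real.sqrt (2 / 3) := Real.sqrt_nonneg _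
    rw [abs_of_pos (by norm_num : (0 : ℝ) < 2), abs_of_nonneg (by positivity)] at hn
    linarith

open scoped Classical in
/-- **THREE-PAYER AT ROOT-CLASS ENDS (named input)**: at every payer `z` of degree `≤ 11` of a `1`-separated configuration, every ROOT-CLASS end ball `b ≠ z`
within `1` of `z` — for any version and any pair of plate systems with slot roots — has pooled deficiency `pooledDef Y b ≥ 3`.  Weaker than lane F's `ThreePayer`
(`threePayerRoot_of_threePayer`); derivable from E1 and the FIVE straight-kind census facts, without `SatCensus11Cross` (sequel). -/
def ThreePayerRoot : Prop :=
  ∀ Y : Finset (EuclideanSpace ℝ (Fin 3)), (∀ p ∈ Y, ∀ q ∈ Y, p ≠ q → 1 ≤ dist p q) →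
  ∀ z ∈ Y, (Y.filter fun q => dist z q = 1).card ≤ 11 →
  ∀ v : WordVersion, ∀ S₁ S₂ : PlateSystem, S₁.RT ⊆ fccSlots → S₂.RT ⊆ fccSlots →
  ∀ b q : EuclideanSpace ℝ (Fin 3), dist z b ≤ 1 → b ≠ z → IsEndPairRootA Y v S₁ S₂ b q → 3 ≤ pooledDef Y b

/-- **Lane F's `ThreePayer` implies `ThreePayerRoot`** (a root-class end pair is an (A)-end pair). -/
theorem threePayerRoot_of_threePayer (h3 : ThreePayer) : ThreePayerRoot :=
  fun Y hY z hz hdeg v S₁ S₂ h₁ h₂ b q hzb hbz hp => h3 Y hY z hz hdeg v S₁ S₂ h₁ h₂ b q hzb hbz (isEndPairA_of_isEndPairRootA hp)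

/-! ### The root core and its star closure -/

section Core

variable (Y : Finset (EuclideanSpace ℝ (Fin 3))) (z : EuclideanSpace ℝ (Fin 3)) (v : WordVersion) (S₁ S₂ : PlateSystem)

open scoped Classical in
/-- **THE ROOT CORE of the payer `z`**: the capping closure, in the payer window `Y ∩ B̄(z, 3)`, of the union of all pieces `pieceOf Y z c S` that carry, as an
(A)-end pair of the piece, a ROOT-CLASS end pair of `Y` ending within `1` of `z` (verbatim `unionCore` with `IsEndPairRootA` for `IsEndPairA`). -/
def rootCore : Finset (EuclideanSpace ℝ (Fin 3)) :=
  capClosure (Y.filter fun x => dist z x ≤ 3)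
    ((Y.filter fun x => dist z x ≤ 3).filter fun x =>
      ∃ c : EuclideanSpace ℝ (Fin 3), ∃ S : EuclideanSpace ℝ (Fin 3) ≃ₗᵢ[ℝ] EuclideanSpace ℝ (Fin 3), x ∈ pieceOf Y z c S ∧
        ∃ b q : EuclideanSpace ℝ (Fin 3), dist z b ≤ 1 ∧ IsEndPairRootA Y v S₁ S₂ b q ∧ IsEndPairA (pieceOf Y z c S) v S₁ S₂ b q)

open scoped Classical in
/-- **THE STAR-CLOSED ROOT CORE**: the star closure ('…SeamStarClosure'), inside the payer window, of the root core. -/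
def rootCoreStar : Finset (EuclideanSpace ℝ (Fin 3)) :=
  starClosure (Y.filter fun x => dist z x ≤ 3) (rootCore Y z v S₁ S₂)

variable {Y z v S₁ S₂}

open scoped Classical in
/-- The root core lies in the payer window. -/
theorem rootCore_subset_window : rootCore Y z v S₁ S₂ ⊆ Y.filter fun x => dist z x ≤ 3 := capClosure_subset (filter_subset _ _)

open scoped Classical in
/-- The root core is cap-closed in the payer window. -/
theorem isCapClosed_rootCore : IsCapClosed Y z (rootCore Y z v S₁ S₂) :=
  ⟨fun _ hx => mem_filter.1 (rootCore_subset_window hx),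
    fun _ hx hzx hcap => mem_capClosure_of_capsTriangleIn (filter_subset _ _) (mem_filter.2 ⟨hx, hzx⟩) hcap⟩

open scoped Classical in
/-- The star-closed root core is star-closed (in particular cap-closed) in the payer window. -/
theorem isStarClosed_rootCoreStar : IsStarClosed Y z (rootCoreStar Y z v S₁ S₂) := isStarClosed_starClosure rootCore_subset_window

open scoped Classical in
/-- The root core lies in its star closure. -/
theorem rootCore_subset_rootCoreStar : rootCore Y z v S₁ S₂ ⊆ rootCoreStar Y z v S₁ S₂ := subset_starClosure _

open scoped Classical in
/-- The star-closed root core lies in the configuration. -/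
theorem rootCoreStar_subset : rootCoreStar Y z v S₁ S₂ ⊆ Y := isStarClosed_rootCoreStar.subset

open scoped Classical in
/-- The star-closed root core lies in the payer window. -/
theorem rootCoreStar_subset_window : rootCoreStar Y z v S₁ S₂ ⊆ Y.filter fun x => dist z x ≤ 3 :=
  fun x hx => mem_filter.2 (isStarClosed_rootCoreStar.capClosed.1 x hx)

open scoped Classical in
/-- A piece carrying a root-class pair near `z` lies in the root core. -/
theorem pieceOf_subset_rootCore {c : EuclideanSpace ℝ (Fin 3)} {S : EuclideanSpace ℝ (Fin 3) ≃ₗᵢ[ℝ] EuclideanSpace ℝ (Fin 3)} {b q : EuclideanSpace ℝ (Fin 3)}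
    (hzb : dist z b ≤ 1) (hp : IsEndPairRootA Y v S₁ S₂ b q) (hpP : IsEndPairA (pieceOf Y z c S) v S₁ S₂ b q) : pieceOf Y z c S ⊆ rootCore Y z v S₁ S₂ :=
  fun _ hx => subset_capClosure _ (mem_filter.2 ⟨pieceOf_subset_window Y z c S hx, c, S, hx, b, q, hzb, hp, hpP⟩)

end Core

/-! ### Root-class pairs descend to any cap-closed superset of the reader's piece (same root) -/

section Descent

variable {Y E : Finset (EuclideanSpace ℝ (Fin 3))} (hY : ∀ p ∈ Y, ∀ p' ∈ Y, p ≠ p' → 1 ≤ dist p p') {v : WordVersion} {S : PlateSystem} (hS : S.RT ⊆ fccSlots)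
  {z : EuclideanSpace ℝ (Fin 3)}

include hY hS in
/-- **A root-class end pair descends, WITH ITS ROOT, to any cap-closed core containing the reader's piece `pieceOf Y z q S.G₀`.**  (Verbatim the argument of
`isEndPairA_of_closed_superset_straight`, with the class `(S.G₀, S.G₀ r)` kept.) -/
theorem isRootEndPair_of_closed_superset (hD : IsCapClosed Y z E) {b q : EuclideanSpace ℝ (Fin 3)} (hp : IsRootEndPair Y v S b q)
    (hsub : pieceOf Y z q S.G₀ ⊆ E) (hzb : dist z b ≤ 1) : IsRootEndPair E v S b q := by
  classical
  have hEY : E ⊆ Y := hD.subset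
  obtain ⟨r, hr, hq, hb, hpay, hbq, hpred, hrd, hnm⟩ := isRootEndPair_straight hS hp
  set G := S.G₀ with hG
  have hu : r ∈ fccSlots := hS hr
  have hdqb : dist q b = 1 := by rw [hbq]; exact dist_slotSite_eq_one G q hu
  have hzq : dist z q ≤ 2 := by linarith [dist_triangle z b q, dist_comm q b]
  have hq0 : G.symm (q - q) ∈ coaxialModule 1 (Real.sqrt (2 / 3)) := by rw [sub_self, map_zero]; exact ⟨0, 0, 0, 0, by simp⟩
  have hqE : q ∈ E := hsub (mem_pieceOf_base G hq (by linarith))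
  have hsq : ∀ w ∈ fccSlots, q + G w ∈ Y → q + G w ∈ E := fun w hw hmem =>
    hsub (mem_pieceOf_of_slot_at G hq0 hw hmem (by linarith [dist_triangle z q (q + G w), dist_slotSite_eq_one G q hw]))
  have hbE : b ∈ E := by rw [hbq] at hb ⊢; exact hsq r hu hb
  have hbmod : G.symm (b - q) ∈ coaxialModule 1 (Real.sqrt (2 / 3)) := by
    rw [hbq, add_sub_cancel_left, LinearIsometryEquiv.symm_apply_apply]; exact slot_mem_module hu
  have hsb : ∀ w ∈ fccSlots, b + G w ∈ Y → b + G w ∈ E := fun w hw hmem =>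
    hsub (mem_pieceOf_of_slot_at G hbmod hw hmem (by linarith [dist_triangle z b (b + G w), dist_slotSite_eq_one G b hw]))
  have hmq : ∀ m, IsTwinReading Y G m q → ∀ w ∈ fccSlots, q + (G w - (2 * ⟪G w, m⟫_ℝ) • m) ∈ Y → q + (G w - (2 * ⟪G w, m⟫_ℝ) • m) ∈ E :=
    fun m htw w hw hmem => reflect_slot_mem_of_capClosed hD hqE hzq htw.1 (fun u hu h0 => hsq u hu (htw.2.1 u hu h0.le)) hw hmem
  have hqdE : q - G r ∈ E := by
    have e : q - G r = q + G (-r) := by rw [map_neg, sub_eq_add_neg]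
    rw [e] at hpred ⊢; exact hsq (-r) (neg_mem_fccSlots hu) hpred
  exact ⟨hqE, hbE, hasTwoPayers_of_subset hY hEY hpay, r, hr, hbq, hqdE, isEndMove_straight_of_sites hEY hrd hbq hnm hbE hsq hsb hmq⟩

include hY hS in
/-- **A root-class end pair ending within `1` of the payer is a root-class end pair of the reader's piece.** -/
theorem isRootEndPair_pieceOf {b q : EuclideanSpace ℝ (Fin 3)} (hzb : dist z b ≤ 1) (hp : IsRootEndPair Y v S b q) :
    IsRootEndPair (pieceOf Y z q S.G₀) v S b q :=
  isRootEndPair_of_closed_superset hY hS (isCapClosed_pieceOf Y z q S.G₀) hp subset_rfl hzb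

end Descent

section StarDescent

variable {Y : Finset (EuclideanSpace ℝ (Fin 3))} (hY : ∀ p ∈ Y, ∀ p' ∈ Y, p ≠ p' → 1 ≤ dist p p') {v : WordVersion} {S₁ S₂ : PlateSystem}
  (h₁ : S₁.RT ⊆ fccSlots) (h₂ : S₂.RT ⊆ fccSlots) {z : EuclideanSpace ℝ (Fin 3)}

include hY h₁ h₂ in
open scoped Classical in
/-- **Every root-class end pair ending within `1` of the payer is a root-class end pair of the star-closed root core.** -/
theorem isEndPairRootA_rootCoreStar {b q : EuclideanSpace ℝ (Fin 3)} (hzb : dist z b ≤ 1) (hp : IsEndPairRootA Y v S₁ S₂ b q) :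
    IsEndPairRootA (rootCoreStar Y z v S₁ S₂) v S₁ S₂ b q := by
  have hD := (isStarClosed_rootCoreStar (Y := Y) (z := z) (v := v) (S₁ := S₁) (S₂ := S₂)).capClosed
  rcases hp with hp₁ | hp₂
  · have hpP := isRootEndPair_pieceOf hY h₁ hzb hp₁
    have hsub : pieceOf Y z q S₁.G₀ ⊆ rootCoreStar Y z v S₁ S₂ :=
      (pieceOf_subset_rootCore hzb (Or.inl hp₁) (isEndPairA_of_isRootEndPair_left S₂ hpP)).trans rootCore_subset_rootCoreStar
    exact Or.inl (isRootEndPair_of_closed_superset hY h₁ hD hp₁ hsub hzb)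
  · have hpP := isRootEndPair_pieceOf hY h₂ hzb hp₂
    have hsub : pieceOf Y z q S₂.G₀ ⊆ rootCoreStar Y z v S₁ S₂ :=
      (pieceOf_subset_rootCore hzb (Or.inr hp₂) (isEndPairA_of_isRootEndPair_right S₁ hpP)).trans rootCore_subset_rootCoreStar
    exact Or.inr (isRootEndPair_of_closed_superset hY h₂ hD hp₂ hsub hzb)

include hY h₁ h₂ in
open scoped Classical in
/-- The root-class multiplicity of a ball within `1` of the payer does not drop in the star-closed root core. -/
theorem endMultRootA_le_rootCoreStar {b : EuclideanSpace ℝ (Fin 3)} (hzb : dist z b ≤ 1) :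
    endMultRootA Y v S₁ S₂ b ≤ endMultRootA (rootCoreStar Y z v S₁ S₂) v S₁ S₂ b := by
  unfold endMultRootA
  refine card_le_card fun q hq => ?_
  obtain ⟨-, hp⟩ := mem_filter.1 hq
  have hp' := isEndPairRootA_rootCoreStar hY h₁ h₂ hzb hp
  exact mem_filter.2 ⟨(isEndPairA_of_isEndPairRootA hp').1, hp'⟩

end StarDescent

/-! ### The graded floor-3 ROOT summand and the comparison -/

open scoped Classical in
/-- **THE GRADED FLOOR-3 ROOT SUMMAND** of the core `D` of the window `X` at the payer `z`: root-class multiplicities of `D` over the three-payer-floored graded pools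
of '…SeamGradedRow' (payer unit, graded gains `12 − deg_X` of the other core balls within `1`, floor `3` at `b ≠ z`). -/
def gradedRootSummand₃ (v : WordVersion) (S₁ S₂ : PlateSystem) (X D : Finset (EuclideanSpace ℝ (Fin 3))) (z : EuclideanSpace ℝ (Fin 3)) : ℝ :=
  ∑ b ∈ D.filter (fun b => dist z b ≤ 1 ∧ 0 < endMultRootA D v S₁ S₂ b), (endMultRootA D v S₁ S₂ b : ℝ) / gradedPool₃ X D z b

open scoped Classical in
/-- **Under `ThreePayerRoot`, the floor-3 graded pool never exceeds the true pool** at a root-class end ball within `1` of the payer. -/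
theorem gradedPool₃_le_pooledDef_root (h3 : ThreePayerRoot) {X D : Finset (EuclideanSpace ℝ (Fin 3))} (hX : ∀ p ∈ X, ∀ q ∈ X, p ≠ q → 1 ≤ dist p q)
    (hDX : D ⊆ X) {z : EuclideanSpace ℝ (Fin 3)} (hz : z ∈ X) (hdeg : (X.filter fun q => dist z q = 1).card ≤ 11) {v : WordVersion} {S₁ S₂ : PlateSystem}
    (h₁ : S₁.RT ⊆ fccSlots) (h₂ : S₂.RT ⊆ fccSlots) {b q : EuclideanSpace ℝ (Fin 3)} (hzb : dist z b ≤ 1) (hp : IsEndPairRootA X v S₁ S₂ b q) :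
    gradedPool₃ X D z b ≤ pooledDef X b := by
  unfold gradedPool₃
  split_ifs with hbz
  · exact gradedPool_le_pooledDef hX hDX hz hdeg hzb
  · exact max_le (h3 X hX z hz hdeg v S₁ S₂ h₁ h₂ b q hzb hbz hp) (gradedPool_le_pooledDef hX hDX hz hdeg hzb)

open scoped Classical in
/-- **`localStatRootA(Y, z) ≤ gradedRootSummand₃ Y (rootCoreStar Y z) z`** at every payer of degree `≤ 11`, under `ThreePayerRoot` alone. -/
theorem localStatRootA_le_gradedRootSummand₃_rootCoreStar (h3 : ThreePayerRoot) {Y : Finset (EuclideanSpace ℝ (Fin 3))}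
    (hY : ∀ p ∈ Y, ∀ p' ∈ Y, p ≠ p' → 1 ≤ dist p p') {v : WordVersion} {S₁ S₂ : PlateSystem} (h₁ : S₁.RT ⊆ fccSlots) (h₂ : S₂.RT ⊆ fccSlots)
    {z : EuclideanSpace ℝ (Fin 3)} (hz : z ∈ Y) (hdeg : (Y.filter fun q => dist z q = 1).card ≤ 11) :
    localStatRootA v S₁ S₂ Y z ≤ gradedRootSummand₃ v S₁ S₂ Y (rootCoreStar Y z v S₁ S₂) z := by
  set D := rootCoreStar Y z v S₁ S₂ with hDdef
  have hDY : D ⊆ Y := rootCoreStar_subset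
  unfold localStatRootA gradedRootSummand₃
  have hsub : Y.filter (fun b => dist z b ≤ 1 ∧ 0 < endMultRootA Y v S₁ S₂ b) ⊆ D.filter (fun b => dist z b ≤ 1 ∧ 0 < endMultRootA D v S₁ S₂ b) := by
    intro b hb
    obtain ⟨-, hzb, he⟩ := mem_filter.1 hb
    have hle : endMultRootA Y v S₁ S₂ b ≤ endMultRootA D v S₁ S₂ b := endMultRootA_le_rootCoreStar hY h₁ h₂ hzb
    obtain ⟨q, hq⟩ := card_pos.1 he
    have hpD := isEndPairRootA_rootCoreStar hY h₁ h₂ hzb (mem_filter.1 hq).2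
    exact mem_filter.2 ⟨(isEndPairA_of_isEndPairRootA hpD).2.1, hzb, lt_of_lt_of_le he hle⟩
  calc ∑ b ∈ Y.filter (fun b => dist z b ≤ 1 ∧ 0 < endMultRootA Y v S₁ S₂ b), (endMultRootA Y v S₁ S₂ b : ℝ) / pooledDef Y b
      ≤ ∑ b ∈ Y.filter (fun b => dist z b ≤ 1 ∧ 0 < endMultRootA Y v S₁ S₂ b), (endMultRootA D v S₁ S₂ b : ℝ) / gradedPool₃ Y D z b := by
        refine sum_le_sum fun b hb => ?_
        obtain ⟨-, hzb, he⟩ := mem_filter.1 hb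
        obtain ⟨q, hq⟩ := card_pos.1 he
        exact div_le_div₀ (Nat.cast_nonneg _) (Nat.cast_le.2 (endMultRootA_le_rootCoreStar hY h₁ h₂ hzb)) (gradedPool₃_pos Y D z b)
          (gradedPool₃_le_pooledDef_root h3 hY hDY hz hdeg h₁ h₂ hzb (mem_filter.1 hq).2)
    _ ≤ ∑ b ∈ D.filter (fun b => dist z b ≤ 1 ∧ 0 < endMultRootA D v S₁ S₂ b), (endMultRootA D v S₁ S₂ b : ℝ) / gradedPool₃ Y D z b :=
        sum_le_sum_of_subset_of_nonneg hsub fun b _ _ => div_nonneg (Nat.cast_nonneg _) (gradedPool₃_pos Y D z b).le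

/-! ### The certificate and the link -/

open scoped Classical in
/-- **BI-FRAME ROOT-CLASS GRADED ROW CERTIFICATE, FLOOR 3, WINDOW FORM (named input — the census object of cf-p1 (ccc)(2)(ii)/(iii))**: for every frame `M`
(the relative orientation of the second grain) and every finite `1`-separated `Y ⊆ B̄(0, 3)` containing the payer `0` with degree `≤ 11`, the graded floor-3 ROOT
summand (`v2`) of the systems `(basalSystem refl, basalSystem M)` on the star-closed root core of `0` is `≤ s`.  Coincidence classes of `M` (module frames) are lane F's
word-net cases; a generic `M` shares no root-end geometry between the two families beyond isolated coincidences. -/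
def BiFrameRootGradedCapWin₃ (s : ℝ) : Prop :=
  ∀ M : EuclideanSpace ℝ (Fin 3) ≃ₗᵢ[ℝ] EuclideanSpace ℝ (Fin 3),
  ∀ Y : Finset (EuclideanSpace ℝ (Fin 3)), (∀ y ∈ Y, dist (0 : EuclideanSpace ℝ (Fin 3)) y ≤ 3) → (∀ p ∈ Y, ∀ q ∈ Y, p ≠ q → 1 ≤ dist p q) →
  (0 : EuclideanSpace ℝ (Fin 3)) ∈ Y → (Y.filter fun q => dist (0 : EuclideanSpace ℝ (Fin 3)) q = 1).card ≤ 11 →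
    gradedRootSummand₃ WordVersion.v2 (basalSystem (LinearIsometryEquiv.refl ℝ (EuclideanSpace ℝ (Fin 3)))) (basalSystem M) Y
      (rootCoreStar Y 0 WordVersion.v2 (basalSystem (LinearIsometryEquiv.refl ℝ (EuclideanSpace ℝ (Fin 3)))) (basalSystem M)) 0 ≤ s

/-- Monotonicity in the line. -/
theorem biFrameRootGradedCapWin₃_mono {s s' : ℝ} (h : BiFrameRootGradedCapWin₃ s) (hs : s ≤ s') : BiFrameRootGradedCapWin₃ s' :=
  fun M Y hW hY h0 hdeg => (h M Y hW hY h0 hdeg).trans hs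

open scoped Classical in
/-- **`ThreePayerRoot → BiFrameRootGradedCapWin₃ s → localStatRootA ≤ s` for EVERY frame pair and payer** (transport `z ↦ 0`, `G₁ ↦ refl`, `G₂ ↦ G₂ ≫ G₁⁻¹`;
radius-`3` locality). -/
theorem localStatRootA_le_of_threePayerRoot_of_biFrameWin₃ (h3 : ThreePayerRoot) {s : ℝ} (h : BiFrameRootGradedCapWin₃ s)
    (G₁ G₂ : EuclideanSpace ℝ (Fin 3) ≃ₗᵢ[ℝ] EuclideanSpace ℝ (Fin 3)) {Y : Finset (EuclideanSpace ℝ (Fin 3))}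
    (hY : ∀ p ∈ Y, ∀ q ∈ Y, p ≠ q → 1 ≤ dist p q) {z : EuclideanSpace ℝ (Fin 3)} (hz : z ∈ Y) (hdeg : (Y.filter fun q => dist z q = 1).card ≤ 11) :
    localStatRootA WordVersion.v2 (basalSystem G₁) (basalSystem G₂) Y z ≤ s := by
  set M : EuclideanSpace ℝ (Fin 3) ≃ₗᵢ[ℝ] EuclideanSpace ℝ (Fin 3) := G₂.trans G₁.symm with hM
  set X := Y.image fun y => G₁.symm y + -G₁.symm z with hXdef
  have hX : ∀ p ∈ X, ∀ q ∈ X, p ≠ q → 1 ≤ dist p q := separated_image_rigid hY G₁.symm _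
  have hYX : Y = X.image fun x => G₁ x + z := by
    have e := image_rigid_symm Y G₁.symm (-G₁.symm z)
    simp only [LinearIsometryEquiv.symm_symm, map_neg, LinearIsometryEquiv.apply_symm_apply, neg_neg] at e
    rw [hXdef, e]
  have h0 : (0 : EuclideanSpace ℝ (Fin 3)) ∈ X := mem_image.2 ⟨z, hz, by simp⟩
  have hzz : z = G₁ 0 + z := by simp
  have hdeg0 : (X.filter fun q => dist (0 : EuclideanSpace ℝ (Fin 3)) q = 1).card ≤ 11 := by
    rw [← degree_transport X G₁ z 0, ← hYX, ← hzz]; exact hdeg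
  have hMG : M.trans G₁ = G₂ := by
    rw [hM]; ext x; simp
  have key := localStatRootA_transport X G₁ z WordVersion.v2 (LinearIsometryEquiv.refl ℝ (EuclideanSpace ℝ (Fin 3))) M basalHexagon basalHexagon 0
  rw [← hYX, ← hzz, LinearIsometryEquiv.refl_trans, hMG] at key
  change localStatRootA WordVersion.v2 ⟨G₁, basalHexagon⟩ ⟨G₂, basalHexagon⟩ Y z ≤ s
  rw [key]
  set X₀ := X.filter fun x => dist (0 : EuclideanSpace ℝ (Fin 3)) x ≤ 3 with hX₀def
  have hagree : ∀ x, dist (0 : EuclideanSpace ℝ (Fin 3)) x ≤ 3 → (x ∈ X ↔ x ∈ X₀) := fun x hx => by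
    rw [hX₀def, mem_filter]; exact ⟨fun h => ⟨h, hx⟩, fun h => h.1⟩
  have h₁ : (basalSystem (LinearIsometryEquiv.refl ℝ (EuclideanSpace ℝ (Fin 3)))).RT ⊆ fccSlots := filter_subset _ _
  have h₂ : (basalSystem M).RT ⊆ fccSlots := filter_subset _ _
  have hloc := localStatRootA_congr_of_agree (v := WordVersion.v2) hagree h₁ h₂ (z := 0) (by simp)
  change localStatRootA WordVersion.v2 (basalSystem (LinearIsometryEquiv.refl ℝ (EuclideanSpace ℝ (Fin 3)))) (basalSystem M) X 0 ≤ s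
  rw [hloc]
  have hX₀ : ∀ p ∈ X₀, ∀ q ∈ X₀, p ≠ q → 1 ≤ dist p q := fun p hp q hq hne => hX p (mem_filter.1 hp).1 q (mem_filter.1 hq).1 hne
  have hW : ∀ y ∈ X₀, dist (0 : EuclideanSpace ℝ (Fin 3)) y ≤ 3 := fun y hy => (mem_filter.1 hy).2
  have h00 : (0 : EuclideanSpace ℝ (Fin 3)) ∈ X₀ := mem_filter.2 ⟨h0, by simp⟩
  have hdeg00 : (X₀.filter fun q => dist (0 : EuclideanSpace ℝ (Fin 3)) q = 1).card ≤ 11 := by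
    rw [← degree_congr_of_agree hagree (y := 0) (by simp)]; exact hdeg0
  exact (localStatRootA_le_gradedRootSummand₃_rootCoreStar h3 hX₀ h₁ h₂ h00 hdeg00).trans (h M X₀ hW hX₀ h00 hdeg00)

/-- **`ThreePayerRoot → BiFrameRootGradedCapWin₃ s → LocalEndRowRootA v2 s (basalSystem G₁) (basalSystem G₂)`** for every frame pair. -/
theorem localEndRowRootA_basal_of_biFrameWin₃ (h3 : ThreePayerRoot) {s : ℝ} (h : BiFrameRootGradedCapWin₃ s)
    (G₁ G₂ : EuclideanSpace ℝ (Fin 3) ≃ₗᵢ[ℝ] EuclideanSpace ℝ (Fin 3)) : LocalEndRowRootA WordVersion.v2 s (basalSystem G₁) (basalSystem G₂) :=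
  fun _ hY _ hz hdeg => localStatRootA_le_of_threePayerRoot_of_biFrameWin₃ h3 h G₁ G₂ hY hz hdeg

/-! ### Antitonicity in the root sets and the by-name LINK -/

/-- A root-class end pair of a sub-rooted system is a root-class end pair of the system (same frame, more roots). -/
theorem isRootEndPair_of_roots {X : Finset (EuclideanSpace ℝ (Fin 3))} {v : WordVersion} {G : EuclideanSpace ℝ (Fin 3) ≃ₗᵢ[ℝ] EuclideanSpace ℝ (Fin 3)}
    {R R' : Finset (EuclideanSpace ℝ (Fin 3))} (hR : R' ⊆ R) {b q : EuclideanSpace ℝ (Fin 3)} (h : IsRootEndPair X v ⟨G, R'⟩ b q) :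
    IsRootEndPair X v ⟨G, R⟩ b q := by
  obtain ⟨hq, hb, hpay, r, hr, hbq, hpred, hmove⟩ := h
  exact ⟨hq, hb, hpay, r, hR hr, hbq, hpred, hmove⟩

open scoped Classical in
/-- Root-class multiplicities are monotone in the root sets. -/
theorem endMultRootA_le_of_roots {X : Finset (EuclideanSpace ℝ (Fin 3))} {v : WordVersion} {G₁ G₂ : EuclideanSpace ℝ (Fin 3) ≃ₗᵢ[ℝ] EuclideanSpace ℝ (Fin 3)}
    {R₁ R₁' R₂ R₂' : Finset (EuclideanSpace ℝ (Fin 3))} (hR₁ : R₁' ⊆ R₁) (hR₂ : R₂' ⊆ R₂) (b : EuclideanSpace ℝ (Fin 3)) :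
    endMultRootA X v ⟨G₁, R₁'⟩ ⟨G₂, R₂'⟩ b ≤ endMultRootA X v ⟨G₁, R₁⟩ ⟨G₂, R₂⟩ b := by
  unfold endMultRootA
  refine card_le_card fun q hq => mem_filter.2 ⟨(mem_filter.1 hq).1, ?_⟩
  rcases (mem_filter.1 hq).2 with h | h
  · exact Or.inl (isRootEndPair_of_roots hR₁ h)
  · exact Or.inr (isRootEndPair_of_roots hR₂ h)

open scoped Classical in
/-- **The root row is ANTITONE in the root sets**: a row for `(⟨G₁, R₁⟩, ⟨G₂, R₂⟩)` gives the row for any sub-rooted pair `(⟨G₁, R₁'⟩, ⟨G₂, R₂'⟩)`. -/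
theorem localEndRowRootA_of_roots {v : WordVersion} {sF : ℝ} {G₁ G₂ : EuclideanSpace ℝ (Fin 3) ≃ₗᵢ[ℝ] EuclideanSpace ℝ (Fin 3)}
    {R₁ R₁' R₂ R₂' : Finset (EuclideanSpace ℝ (Fin 3))} (hR₁ : R₁' ⊆ R₁) (hR₂ : R₂' ⊆ R₂) (h : LocalEndRowRootA v sF ⟨G₁, R₁⟩ ⟨G₂, R₂⟩) :
    LocalEndRowRootA v sF ⟨G₁, R₁'⟩ ⟨G₂, R₂'⟩ := by
  intro X hX z hz hz11
  refine le_trans ?_ (h X hX z hz hz11)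
  have hD : ∀ b, 0 ≤ pooledDef X b := by
    intro b
    refine sum_nonneg fun z' hz' => ?_
    have : ((X.filter fun q => dist z' q = 1).card : ℝ) ≤ 11 := by exact_mod_cast (mem_filter.1 hz').2.2
    linarith
  calc ∑ b ∈ X.filter (fun b => dist z b ≤ 1 ∧ 0 < endMultRootA X v ⟨G₁, R₁'⟩ ⟨G₂, R₂'⟩ b),
        (endMultRootA X v ⟨G₁, R₁'⟩ ⟨G₂, R₂'⟩ b : ℝ) / pooledDef X b
      ≤ ∑ b ∈ X.filter (fun b => dist z b ≤ 1 ∧ 0 < endMultRootA X v ⟨G₁, R₁'⟩ ⟨G₂, R₂'⟩ b),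
          (endMultRootA X v ⟨G₁, R₁⟩ ⟨G₂, R₂⟩ b : ℝ) / pooledDef X b :=
        sum_le_sum fun b _ => div_le_div_of_nonneg_right (by exact_mod_cast endMultRootA_le_of_roots hR₁ hR₂ b) (hD b)
    _ ≤ ∑ b ∈ X.filter (fun b => dist z b ≤ 1 ∧ 0 < endMultRootA X v ⟨G₁, R₁⟩ ⟨G₂, R₂⟩ b),
          (endMultRootA X v ⟨G₁, R₁⟩ ⟨G₂, R₂⟩ b : ℝ) / pooledDef X b := by
        refine sum_le_sum_of_subset_of_nonneg (fun b hb => ?_) fun b _ _ => div_nonneg (Nat.cast_nonneg _) (hD b)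
        obtain ⟨hbX, hd, hpos⟩ := mem_filter.1 hb
        exact mem_filter.2 ⟨hbX, hd, lt_of_lt_of_le hpos (endMultRootA_le_of_roots hR₁ hR₂ b)⟩

/-- **THE LINK (cf-p1 (ccc)(2)(ii))**: `ThreePayerRoot → BiFrameRootGradedCapWin₃ s → EndRowBiFrameRootA v2 s` — the bi-frame root-class row BY NAME for the (β)
two-plate pooling (`hexagon_twoPlate_sources_le_payers_cuts_root`), for EVERY frame pair `(G₁, G₂)` (systems `⟨G₁, inPlaneRoots G₁ 1⟩`, `⟨G₂, inPlaneRoots G₂ (−1)⟩`,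
sub-rooted in `basalSystem G₁`, `basalSystem G₂`). -/
theorem endRowBiFrameRootA_of_threePayerRoot_of_biFrameWin₃ (h3 : ThreePayerRoot) {s : ℝ} (h : BiFrameRootGradedCapWin₃ s) :
    EndRowBiFrameRootA WordVersion.v2 s :=
  fun G₁ G₂ => localEndRowRootA_of_roots (inPlaneRoots_subset_basalHexagon G₁ 1) (inPlaneRoots_subset_basalHexagon G₂ (-1))
    (localEndRowRootA_basal_of_biFrameWin₃ h3 h G₁ G₂)

/-- **THE LINK under lane F's `ThreePayer`** (registered/derived in lane F v8.4 as `stub_threePayer`): `ThreePayer → BiFrameRootGradedCapWin₃ s → EndRowBiFrameRootA v2 s`. -/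
theorem endRowBiFrameRootA_of_threePayer_of_biFrameWin₃ (h3 : ThreePayer) {s : ℝ} (h : BiFrameRootGradedCapWin₃ s) : EndRowBiFrameRootA WordVersion.v2 s :=
  endRowBiFrameRootA_of_threePayerRoot_of_biFrameWin₃ (threePayerRoot_of_threePayer h3) h

/-- The `9/2` instance lane T consumes, spelled out. -/
theorem endRowBiFrameRootA_nineHalves_of_threePayer (h3 : ThreePayer) (h : BiFrameRootGradedCapWin₃ (9 / 2)) : EndRowBiFrameRootA WordVersion.v2 (9 / 2) :=
  endRowBiFrameRootA_of_threePayer_of_biFrameWin₃ h3 h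

end TailResidue

end Summit.Ventures.Crystal3D.Theorems

end
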